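import Mathlib

set_option linter.dupNamespace false
set_option linter.unusedSectionVars false

/-!
# GlueFreeA (lens 4, g29; (P9) glue step (g3) of the (c0) road) — FROM FREENESS ON `B` TO THE POOL HYPOTHESIS (d1)

Blocker `X = AbsorptionDial.NoPerfectPolyOdd` (item 28487); decomp-qadv lens 4, g29.  `ColumnBridgeB.loss_of_freeDisperse_prepared` wants
(d1): every non-zero `γ ∈ 𝔽_p^{r+k′}` gives the combined form `Σ_j γ_j Lfull_j` weight `≥ w` on the pool `T : Fin m ↪ Fin n`, where
`Lfull = Fin.append (cross rows of the cut e) (free label rows Λf)` restricted to the pool.  The free branch of kernel Y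
(`JointFreenessLawA.free_dichotomy`, `t = 1`, `S = M + Mᵀ`, `I = range e`) gives this for combinations with a NON-ZERO CROSS PART (weight
counted on `B`), and the label preparation (`LabelPreparationA.exists_puncture` + relabelling) gives it for the PURE free-label combinations.
`hfree_of_free_prepared` is the index bookkeeping joining the two when the pool ENUMERATES `B`:

* `pencilOf γ` (the cross coefficients of `γ` spread on `Fin n` along `e`), `sum_pencilOf` (`Σ_i pencilOf γ i · f i = Σ_j γ_j f (e j)`),
  `pencilOf_support`; `combined_eq` (the combined form at a pool point, split by `Fin.sum_univ_add`); `card_filter_pool` (counting on the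
  pool = counting on `B`);
* ★ `hfree_of_free_prepared`.

Supports stmt-QuantumAdvantage-28487 (record; the residual `X` is NOT claimed).
-/

open Finset

namespace Summit.QuantumAdvantage.QuantumAdvantage.Theorems.GlueFree

variable {p : ℕ} {n m r k' : ℕ}

/-- the cross coefficients of `γ` as a vector on `Fin n` supported on the cut `range e` -/
def pencilOf (e : Fin r ↪ Fin n) (γ : Fin (r + k') → ZMod p) : Fin n → ZMod p :=
  fun i => ∑ j : Fin r, if e j = i then γ (Fin.castAdd k' j) else 0

/-- pairing against the spread vector = pairing the cross coefficients along `e` -/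
theorem sum_pencilOf (e : Fin r ↪ Fin n) (γ : Fin (r + k') → ZMod p) (f : Fin n → ZMod p) :
    ∑ i, pencilOf e γ i * f i = ∑ j : Fin r, γ (Fin.castAdd k' j) * f (e j) := by
  unfold pencilOf
  simp_rw [sum_mul]
  rw [sum_comm]
  refine sum_congr rfl fun j _ => ?_
  simp_rw [ite_mul, zero_mul]
  rw [sum_ite_eq univ (e j) (fun i => γ (Fin.castAdd k' j) * f i)]
  simp

/-- the spread vector vanishes off the cut -/
theorem pencilOf_support (e : Fin r ↪ Fin n) (γ : Fin (r + k') → ZMod p) (i : Fin n) (hi : ∀ j, e j ≠ i) :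
    pencilOf e γ i = 0 := by
  unfold pencilOf
  exact sum_eq_zero fun j _ => if_neg (hi j)

/-- the spread vector at a cut point -/
theorem pencilOf_apply (e : Fin r ↪ Fin n) (γ : Fin (r + k') → ZMod p) (j : Fin r) :
    pencilOf e γ (e j) = γ (Fin.castAdd k' j) := by
  unfold pencilOf
  rw [sum_eq_single j]
  · rw [if_pos rfl]
  · intro j' _ hj'
    rw [if_neg]
    exact fun h => hj' (e.injective h)
  · intro h; exact absurd (mem_univ j) h

/-- the combined form `Σ_j γ_j Lfull_j` at the pool point `T i`, split into its cross part and its free-label part -/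
theorem combined_eq (M : Fin n → Fin n → ZMod p) (Λf : Fin k' → Fin n → ZMod p) (e : Fin r ↪ Fin n) (T : Fin m ↪ Fin n)
    (γ : Fin (r + k') → ZMod p) (i : Fin m) :
    ∑ j, γ j * Fin.append (fun j i => M (e j) (T i) + M (T i) (e j)) (fun j i => Λf j (T i)) j i
      = (∑ l, pencilOf e γ l * (M l (T i) + M (T i) l)) + ∑ q, γ (Fin.natAdd r q) * Λf q (T i) := by
  rw [Fin.sum_univ_add, sum_pencilOf]
  congr 1
  · refine sum_congr rfl fun j _ => ?_
    rw [Fin.append_left]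
  · refine sum_congr rfl fun q _ => ?_
    rw [Fin.append_right]

/-- counting on the pool is counting on `B` when the pool enumerates `B` -/
theorem card_filter_pool (T : Fin m ↪ Fin n) (B : Finset (Fin n)) (hTB : ∀ l, l ∈ B ↔ ∃ i, T i = l)
    (P : Fin n → Prop) [DecidablePred P] :
    (univ.filter fun i : Fin m => P (T i)).card = (B.filter P).card := by
  rw [← card_map T]
  congr 1
  ext l
  simp only [mem_map, mem_filter, mem_univ, true_and]
  constructor
  · rintro ⟨i, hi, rfl⟩
    exact ⟨(hTB _).mpr ⟨i, rfl⟩, hi⟩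
  · rintro ⟨hl, hP⟩
    obtain ⟨i, rfl⟩ := (hTB l).mp hl
    exact ⟨i, hP, rfl⟩

/-- **(g3).**  If (Y) every combination with a non-zero cross part supported on the cut has weight `≥ w` on `B`, and (PREP) every non-zero
pure free-label combination has weight `≥ w` on `B`, then every non-zero `γ ∈ 𝔽_p^{r+k′}` gives the combined pool form weight `≥ w` —
hypothesis (d1) of `ColumnBridgeB.loss_of_freeDisperse_prepared` (with `Lfull` unfolded) for a pool `T` enumerating `B`. -/
theorem hfree_of_free_prepared (M : Fin n → Fin n → ZMod p) (Λf : Fin k' → Fin n → ZMod p) (e : Fin r ↪ Fin n)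
    (T : Fin m ↪ Fin n) (B : Finset (Fin n)) (hTB : ∀ l, l ∈ B ↔ ∃ i, T i = l) (w : ℕ)
    (hY : ∀ (a : Fin n → ZMod p) (a' : Fin k' → ZMod p), (∀ i, (∀ j, e j ≠ i) → a i = 0) → (∃ i, a i ≠ 0) →
      w ≤ (B.filter fun l => (∑ i, a i * (M i l + M l i)) + ∑ q, a' q * Λf q l ≠ 0).card)
    (hP : ∀ a' : Fin k' → ZMod p, a' ≠ 0 → w ≤ (B.filter fun l => (∑ q, a' q * Λf q l) ≠ 0).card)
    (γ : Fin (r + k') → ZMod p) (hγ : γ ≠ 0) :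
    w ≤ (univ.filter fun i : Fin m =>
      (∑ j, γ j * Fin.append (fun j i => M (e j) (T i) + M (T i) (e j)) (fun j i => Λf j (T i)) j i) ≠ 0).card := by
  classical
  simp_rw [combined_eq]
  rw [card_filter_pool T B hTB (fun l => (∑ l', pencilOf e γ l' * (M l' l + M l l')) + ∑ q, γ (Fin.natAdd r q) * Λf q l ≠ 0)]
  by_cases hcross : ∃ j : Fin r, γ (Fin.castAdd k' j) ≠ 0
  · obtain ⟨j, hj⟩ := hcross
    exact hY (pencilOf e γ) (fun q => γ (Fin.natAdd r q)) (fun i hi => pencilOf_support e γ i hi)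
      ⟨e j, by rw [pencilOf_apply]; exact hj⟩
  · push Not at hcross
    have hpen : ∀ l, pencilOf e γ l = 0 := by
      intro l
      unfold pencilOf
      exact sum_eq_zero fun j _ => by rw [hcross j]; simp
    simp_rw [hpen, zero_mul, sum_const_zero, zero_add]
    refine hP _ fun h0 => hγ ?_
    funext j
    refine Fin.addCases (fun j' => ?_) (fun q => ?_) j
    · exact hcross j'
    · exact congrFun h0 q

end Summit.QuantumAdvantage.QuantumAdvantage.Theorems.GlueFree
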